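import Summits.QuantumFields.BalabanUV.Beta.GAN24.LegLetterRowsOfLegChain

/-!
# `BalabanUV.Beta.GAN24.LegFirstWindowRows` — binder row G-an2-4 ∕ (CONV-C), W-slot, the (α-0) parity re-cut, row L11 (Q-L): **THE FIRST-WINDOW ROWS (H0)_δ AND (H0d)_δ
# OF MY FILEs 3 ∕ 5 DISCHARGED FOR EVERY SMALL RATE** — the `rdiv` letter of a `LocStencil₂` table is `LocStencil₂` at the same rate (constant `(d+1)(e^δ+1)·C`), and the
# finitely many members `y_0 … y_{k₀}` of the parity `ε`-member have ONE constant at every rate `δ ≤ δ₀` (G-an2-4 formalisation swarm, leaf prover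
# `b2b-balaban-gan24-formalise-leaf-03`, gen 67; FILE 6 of the journal INTENT [LEAF03-G67-ONLINE] «(Q-L) LETTER ROWS ⟸ THE RULED DISPLAY»; over MY FILE 3
# `LegLetterRowsOfLegChain` (member boundedness), leaf-01's `T2HybridCellsComb.exists_locStencil₂_unitS₂_T2RecAt` and the OWNER's `BiTableParityHalves.biLoc_half`)

NOT IN PRINT; OUR BOOKKEEPING ([folklore] one triangle inequality + a finite minimum of rates; 0 `def`, 0 cited facts, 0 `def … : Prop`, 0 sorry).  HONEST FRAMING (cell
contract, verbatim): «discharging `BetaPertH` makes Bałaban's UV stability UNCONDITIONAL — a real constructive-QFT result; it is NOT the continuum limit and NOT the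
Clay problem.»  HONEST DEPENDENCY (verbatim): «continuum YM on T⁴ ⇐ BetaPertH ∧ nine spine estimates (0/9 proved); BetaPertH ⇐ (D1) ∧ (D4) ∧ CAP+tail; G-an2-4
gates asym, D1 and NE2/3/4.»

WHAT (generic `d`; objects as in MY FILE 3: `T̃_l`, `P`, `y_l := ½ • (T̃_l + ε • P T̃_l)`, `|ε| ≤ 1`).
* §1 `exp_shift_unitVec_le` (`e^{−δ(|x−u|₁ + |p−e_β−u|₁)} ≤ e^{δ}·e^{−δ(|x−u|₁ + |p−u|₁)}`, `δ ≥ 0`; `StepJetData.l1_add_le ∕ l1_unitVec`), **`locStencil₂_rdiv`** —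
  `LocStencil₂ X C δ ⟹ LocStencil₂ (fun s ↦ rdiv (X s)) ((d+1)·(e^δ+1)·C) δ` —, `locStencil₂_sub` (via MY FILE 2's `locStencil₂_neg`).
* §2 `members_common_rows` — for every `k`: `∃ δ₀ > 0, ∃ M ≥ 0, ∀ i < k, ∀ δ ∈ (0, δ₀], LocStencil₂ (y_i) M δ` (leaf-01's `exists_locStencil₂_unitS₂_T2RecAt` per level ⨾ the
  OWNER's `BiTableParityHalves.biLoc_half` ⨾ `LocStencil₂.mono` in the rate; induction on `k` with `min` of rates, `max` of constants).
* §3 **`firstWindow_rows_halfMember`** (generic `d`) ∕ **`firstWindow_rows_halfMember_three`** (`d = 3`): for every window `k₀`,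
  `∃ δ₀ > 0, ∀ δ, 0 < δ → δ ≤ δ₀ → ∃ M ≥ 0, (∀ i < k₀, LocStencil₂ (rdiv ∘ y_i) M δ) ∧ (∀ i < k₀, LocStencil₂ (rdiv ∘ y_{i+1} − rdiv ∘ y_i) M δ)` — the rows (H0)_δ of
  MY FILE 3 `legRows_halfMember_of_chain_rows` and (H0d)_δ of MY FILE 5 `legDriftRows_halfMember_of_chain_rows` in their EXACT spellings, DISCHARGED for every rate
  `δ ≤ δ₀` (the consumer of (H1♮)_δ picks `δ`).
Asserts NO shape of Bałaban's tables beyond the finitely many members' own `LocStencil₂` classes; discharges NOTHING of (H1♮) ∕ (H2) ∕ (H3) ∕ (Q-L) ∕ (C) ∕ «T2Shape» ∕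
«T2Drift» ∕ (hW, hWall); NEVER «G-an2-4 closed» as (CONV-C); NOT D1, NOT `BetaPertH`, NOT continuum, NOT Clay; not in print.
Unit `b2b-balaban-gan24-formalise-leaf-03` (gen 67), 2026-08-23.
-/

noncomputable section
open Finset
open scoped BigOperators
open Literature.MathematicalPhysics.QuantumFieldTheory
open Literature.MathematicalPhysics.QuantumFieldTheory.Balaban1983to89
open Literature.MathematicalPhysics.QuantumFieldTheory.Balaban1983to89.Beta
open B12Sec2to5 (l1 l1_nonneg)
open ExpKernelCalculus (MKer Site BiLoc)
open OneStepResolventKernel (Fib)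
open AffineAveraging (box toSite)
open AveragingMixedJetTables (mixFFAt)
open BalabanCompositeJets (LocStencil₂ LocStencil₂.mono LocStencil₂.nonneg)
open StepJetData (l1_add_le l1_unitVec)
open Summit.QuantumFields.BalabanUV.Beta.TameKernelCalculus (trK)
open Summit.QuantumFields.BalabanUV.Beta.BorderedHessian (sgnK)
open Summit.QuantumFields.BalabanUV.Beta.SecondOrderUnits (unitS₂)
open Summit.QuantumFields.BalabanUV.Beta.SpineRooted (T2RecAt)
open Summit.QuantumFields.BalabanUV.Beta.GAN24.CombesThomas (sfStep smStep)
open Summit.QuantumFields.BalabanUV.Beta.GAN24.WSlotT2OfPieces (locStencil₂_add locStencil₂_mono locStencil₂_zero)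
open Summit.QuantumFields.BalabanUV.Beta.GAN24.T2HybridCellsComb (exists_locStencil₂_unitS₂_T2RecAt)
open Summit.QuantumFields.BalabanUV.Beta.GAN24.BiTableParityHalves (biLoc_half)
open Summit.QuantumFields.BalabanUV.Beta.GAN24.Lin4LegTower (rdiv rdiv_apply)
open Summit.QuantumFields.BalabanUV.Beta.GAN24.LegLetterParity (locStencil₂_neg)

namespace Summit.QuantumFields.BalabanUV.Beta.GAN24.LegFirstWindowRows

variable {d : ℕ}

/-! ## §1 The `rdiv` letter of a `LocStencil₂` table -/

/-- [folklore] **A UNIT SHIFT OF THE POSITION INDEX COSTS `e^δ`** (`δ ≥ 0`): `e^{−δ(|x−u|₁ + |p−e_β−u|₁)} ≤ e^{δ}·e^{−δ(|x−u|₁ + |p−u|₁)}`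
(`|p−u|₁ ≤ |p−e_β−u|₁ + |e_β|₁`, `StepJetData.l1_add_le ∕ l1_unitVec`). -/
theorem exp_shift_unitVec_le {δ : ℝ} (hδ : 0 ≤ δ) (x p u : Fin (d + 1) → ℤ) (β : Fin (d + 1)) :
    Real.exp (-δ * (l1 (x - u) + l1 (p - B6BondElimination.unitVec β - u)))
      ≤ Real.exp δ * Real.exp (-δ * (l1 (x - u) + l1 (p - u))) := by
  rw [← Real.exp_add]
  refine Real.exp_le_exp.mpr ?_
  have h1 : l1 (p - u) ≤ l1 (p - B6BondElimination.unitVec β - u) + 1 := by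
    have e : p - u = (p - B6BondElimination.unitVec β - u) + B6BondElimination.unitVec β := by abel
    have h := l1_add_le (p - B6BondElimination.unitVec β - u) (B6BondElimination.unitVec β)
    rw [← e, l1_unitVec] at h
    exact h
  nlinarith [l1_nonneg (x - u), l1_nonneg (p - B6BondElimination.unitVec β - u)]

/-- [folklore] **THE `rdiv` LETTER OF A `LocStencil₂` TABLE IS `LocStencil₂` AT THE SAME RATE**, constant `(d+1)·(e^δ+1)·C` (`δ ≥ 0`). -/
theorem locStencil₂_rdiv {X : (Fin (d + 1) → (Fin (d + 1) → ℤ) → Fin (d + 1) → (Fin (d + 1) → ℤ) → MKer (d + 1) (Fib d))} {C δ : ℝ} (h : LocStencil₂ X C δ) (hδ : 0 ≤ δ) :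
    LocStencil₂ (fun κ u κ' u' => rdiv (X κ u κ' u')) (((d + 1 : ℕ) : ℝ) * (Real.exp δ + 1) * C) δ := by
  intro κ u κ' u' x p a b
  have hC : 0 ≤ C := h.nonneg
  set w : ℝ := C * Real.exp (-δ * l1 (u' - u)) * Real.exp (-δ * (l1 (x - u) + l1 (p - u))) with hw
  have hw0 : 0 ≤ w := by positivity
  have hterm : ∀ β : Fin (d + 1),
      |X κ u κ' u' x (p - B6BondElimination.unitVec β) a (Sum.inl β) - X κ u κ' u' x p a (Sum.inl β)| ≤ Real.exp δ * w + w := by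
    intro β
    have hA := h κ u κ' u' x (p - B6BondElimination.unitVec β) a (Sum.inl β)
    have hB := h κ u κ' u' x p a (Sum.inl β)
    have hA' : |X κ u κ' u' x (p - B6BondElimination.unitVec β) a (Sum.inl β)| ≤ Real.exp δ * w := by
      refine hA.trans ?_
      have hs := exp_shift_unitVec_le hδ x p u β
      have hc : 0 ≤ C * Real.exp (-δ * l1 (u' - u)) := by positivity
      calc C * Real.exp (-δ * l1 (u' - u)) * Real.exp (-δ * (l1 (x - u) + l1 (p - B6BondElimination.unitVec β - u)))
          ≤ C * Real.exp (-δ * l1 (u' - u)) * (Real.exp δ * Real.exp (-δ * (l1 (x - u) + l1 (p - u)))) :=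
            mul_le_mul_of_nonneg_left hs hc
        _ = Real.exp δ * w := by rw [hw]; ring
    exact (abs_sub _ _).trans (add_le_add hA' hB)
  show |rdiv (X κ u κ' u') x p a b| ≤ _
  rw [rdiv_apply]
  calc |∑ β, (X κ u κ' u' x (p - B6BondElimination.unitVec β) a (Sum.inl β) - X κ u κ' u' x p a (Sum.inl β))|
      ≤ ∑ β, |X κ u κ' u' x (p - B6BondElimination.unitVec β) a (Sum.inl β) - X κ u κ' u' x p a (Sum.inl β)| := Finset.abs_sum_le_sum_abs _ _
    _ ≤ ∑ _β : Fin (d + 1), (Real.exp δ * w + w) := Finset.sum_le_sum fun β _ => hterm β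
    _ = ((d + 1 : ℕ) : ℝ) * (Real.exp δ + 1) * C * Real.exp (-δ * l1 (u' - u)) * Real.exp (-δ * (l1 (x - u) + l1 (p - u))) := by
        rw [Finset.sum_const, Finset.card_univ, Fintype.card_fin, nsmul_eq_mul, hw]; ring

/-- [folklore] Difference of two `LocStencil₂` families at a common rate (constants add; `locStencil₂_add` + MY FILE 2's `locStencil₂_neg`). -/
theorem locStencil₂_sub {A B : (Fin (d + 1) → (Fin (d + 1) → ℤ) → Fin (d + 1) → (Fin (d + 1) → ℤ) → MKer (d + 1) (Fib d))} {CA CB δ : ℝ} (hA : LocStencil₂ A CA δ) (hB : LocStencil₂ B CB δ) :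
    LocStencil₂ (A - B) (CA + CB) δ := by
  rw [sub_eq_add_neg]
  exact locStencil₂_add hA (locStencil₂_neg hB)

/-! ## §2 Finitely many members at one constant, every small rate -/

section Member

variable {Lc : ℕ} [NeZero Lc] {r : Fin (d + 1) → ℕ}
/-- [folklore] **THE FIRST `k` MEMBERS `y_0 … y_{k−1}` OF THE `ε`-MEMBER HAVE ONE `LocStencil₂` CONSTANT AT EVERY RATE `δ ≤ δ₀`** (`|ε| ≤ 1`; per level leaf-01's
`exists_locStencil₂_unitS₂_T2RecAt` ⨾ the OWNER's `BiTableParityHalves.biLoc_half`, then `min` of the rates and `max` of the constants by induction on `k`, `LocStencil₂.mono`). -/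
theorem members_common_rows (hLc : 1 ≤ Lc) (hr : r ∈ box (d + 1) Lc) (cE cVH cΛ cE₂ cB : ℝ) (Tc : Fin 4 → Fin 4 → Fin 4 → Fin 4 → ℝ)
    {vh₂S : (Fin (d + 1) → (Fin (d + 1) → ℤ) → Fin (d + 1) → (Fin (d + 1) → ℤ) → MKer (d + 1) (Fib d))} (hB : ∃ C δ : ℝ, 0 < δ ∧ LocStencil₂ vh₂S C δ) {ε : ℝ} (hε : |ε| ≤ 1) (k : ℕ) :
    ∃ δ₀ M : ℝ, 0 < δ₀ ∧ 0 ≤ M ∧ ∀ i, i < k → ∀ δ, δ ≤ δ₀ →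
      LocStencil₂ (((1 : ℝ) / 2) • (unitS₂ (sfStep Lc i) (smStep d Lc i) (T2RecAt d Lc (toSite r) cE cVH cΛ cE₂ cB Tc vh₂S (mixFFAt (toSite r) Lc) i) + ε • fun κ u κ' u' => sgnK (trK ((unitS₂ (sfStep Lc i) (smStep d Lc i) (T2RecAt d Lc (toSite r) cE cVH cΛ cE₂ cB Tc vh₂S (mixFFAt (toSite r) Lc) i)) κ u κ' u')))) M δ := by
  induction k with
  | zero => exact ⟨1, 0, one_pos, le_rfl, fun i hi => absurd hi (Nat.not_lt_zero i)⟩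
  | succ k ih =>
    obtain ⟨δ₀, M, hδ₀, hM, hrows⟩ := ih
    obtain ⟨Ck, δk, hδk, hk⟩ := exists_locStencil₂_unitS₂_T2RecAt hLc hr cE cVH cΛ cE₂ cB Tc hB k
    have hyk : LocStencil₂ (((1 : ℝ) / 2) • (unitS₂ (sfStep Lc k) (smStep d Lc k) (T2RecAt d Lc (toSite r) cE cVH cΛ cE₂ cB Tc vh₂S (mixFFAt (toSite r) Lc) k) + ε • fun κ u κ' u' => sgnK (trK ((unitS₂ (sfStep Lc k) (smStep d Lc k) (T2RecAt d Lc (toSite r) cE cVH cΛ cE₂ cB Tc vh₂S (mixFFAt (toSite r) Lc) k)) κ u κ' u')))) Ck δk :=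
      fun κ u κ' u' => biLoc_half (hk κ u κ' u') hε
    refine ⟨min δ₀ δk, max M Ck, lt_min hδ₀ hδk, hM.trans (le_max_left _ _), fun i hi δ hδ => ?_⟩
    rcases Nat.lt_succ_iff_lt_or_eq.mp hi with hlt | heq
    · exact locStencil₂_mono ((hrows i hlt δ (hδ.trans (min_le_left _ _)))) (le_max_left _ _)
    · subst heq
      exact locStencil₂_mono (hyk.mono (hδ.trans (min_le_right _ _))) (le_max_right _ _)

/-! ## §3 (H0)_δ and (H0d)_δ discharged for every small rate -/

/-- NOT IN PRINT; OUR BOOKKEEPING.  **THE FIRST-WINDOW ROWS OF MY FILEs 3 ∕ 5, DISCHARGED** (generic `d`, `1 ≤ Lc`, in-block root, `|ε| ≤ 1`, any window `k₀`): there is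
`δ₀ > 0` such that for EVERY rate `0 < δ ≤ δ₀` ONE constant `M ≥ 0` bounds (H0)_δ `∀ i < k₀, LocStencil₂ (rdiv ∘ y_i) M δ` AND (H0d)_δ
`∀ i < k₀, LocStencil₂ (rdiv ∘ y_{i+1} − rdiv ∘ y_i) M δ`, in the EXACT spellings of `legRows_halfMember_of_chain_rows` ∕ `legDriftRows_halfMember_of_chain_rows`. -/
theorem firstWindow_rows_halfMember (hLc : 1 ≤ Lc) (hr : r ∈ box (d + 1) Lc) (cE cVH cΛ cE₂ cB : ℝ) (Tc : Fin 4 → Fin 4 → Fin 4 → Fin 4 → ℝ)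
    {vh₂S : (Fin (d + 1) → (Fin (d + 1) → ℤ) → Fin (d + 1) → (Fin (d + 1) → ℤ) → MKer (d + 1) (Fib d))} (hB : ∃ C δ : ℝ, 0 < δ ∧ LocStencil₂ vh₂S C δ) {ε : ℝ} (hε : |ε| ≤ 1) (k₀ : ℕ) :
    ∃ δ₀ : ℝ, 0 < δ₀ ∧ ∀ δ, 0 < δ → δ ≤ δ₀ → ∃ M : ℝ, 0 ≤ M ∧
      (∀ i, i < k₀ → LocStencil₂ (fun κ u κ' u' => rdiv ((((1 : ℝ) / 2) • (unitS₂ (sfStep Lc i) (smStep d Lc i) (T2RecAt d Lc (toSite r) cE cVH cΛ cE₂ cB Tc vh₂S (mixFFAt (toSite r) Lc) i) + ε • fun κ u κ' u' => sgnK (trK ((unitS₂ (sfStep Lc i) (smStep d Lc i) (T2RecAt d Lc (toSite r) cE cVH cΛ cE₂ cB Tc vh₂S (mixFFAt (toSite r) Lc) i)) κ u κ' u')))) κ u κ' u')) M δ) ∧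
      (∀ i, i < k₀ → LocStencil₂ ((fun κ u κ' u' => rdiv ((((1 : ℝ) / 2) • (unitS₂ (sfStep Lc (i + 1)) (smStep d Lc (i + 1)) (T2RecAt d Lc (toSite r) cE cVH cΛ cE₂ cB Tc vh₂S (mixFFAt (toSite r) Lc) (i + 1)) + ε • fun κ u κ' u' => sgnK (trK ((unitS₂ (sfStep Lc (i + 1)) (smStep d Lc (i + 1)) (T2RecAt d Lc (toSite r) cE cVH cΛ cE₂ cB Tc vh₂S (mixFFAt (toSite r) Lc) (i + 1))) κ u κ' u')))) κ u κ' u'))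
        - (fun κ u κ' u' => rdiv ((((1 : ℝ) / 2) • (unitS₂ (sfStep Lc i) (smStep d Lc i) (T2RecAt d Lc (toSite r) cE cVH cΛ cE₂ cB Tc vh₂S (mixFFAt (toSite r) Lc) i) + ε • fun κ u κ' u' => sgnK (trK ((unitS₂ (sfStep Lc i) (smStep d Lc i) (T2RecAt d Lc (toSite r) cE cVH cΛ cE₂ cB Tc vh₂S (mixFFAt (toSite r) Lc) i)) κ u κ' u')))) κ u κ' u'))) M δ) := by
  obtain ⟨δ₀, M, hδ₀, hM, hrows⟩ := members_common_rows hLc hr cE cVH cΛ cE₂ cB Tc hB hε (k₀ + 1)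
  refine ⟨δ₀, hδ₀, fun δ hδ hδδ₀ => ?_⟩
  -- the `rdiv` letters of the members `i ≤ k₀` at rate `δ`, one constant
  set M₁ : ℝ := ((d + 1 : ℕ) : ℝ) * (Real.exp δ + 1) * M with hM₁
  have hM₁0 : 0 ≤ M₁ := by positivity
  have hR : ∀ i, i < k₀ + 1 → LocStencil₂ (fun κ u κ' u' => rdiv ((((1 : ℝ) / 2) • (unitS₂ (sfStep Lc i) (smStep d Lc i) (T2RecAt d Lc (toSite r) cE cVH cΛ cE₂ cB Tc vh₂S (mixFFAt (toSite r) Lc) i) + ε • fun κ u κ' u' => sgnK (trK ((unitS₂ (sfStep Lc i) (smStep d Lc i) (T2RecAt d Lc (toSite r) cE cVH cΛ cE₂ cB Tc vh₂S (mixFFAt (toSite r) Lc) i)) κ u κ' u')))) κ u κ' u')) M₁ δ :=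
    fun i hi => locStencil₂_rdiv (hrows i hi δ hδδ₀) hδ.le
  refine ⟨M₁ + M₁, by positivity, fun i hi => locStencil₂_mono (hR i (Nat.lt_succ_of_lt hi)) (by linarith), fun i hi => ?_⟩
  exact locStencil₂_sub (hR (i + 1) (Nat.succ_lt_succ hi)) (hR i (Nat.lt_succ_of_lt hi))

end Member

end Summit.QuantumFields.BalabanUV.Beta.GAN24.LegFirstWindowRows

namespace Summit.QuantumFields.BalabanUV.Beta.GAN24.LegFirstWindowRows

section Three

variable {Lc : ℕ} [NeZero Lc] {r : Fin (3 + 1) → ℕ}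
/-- NOT IN PRINT; OUR BOOKKEEPING.  **`d = 3`: (H0)_δ ∧ (H0d)_δ OF `legRows_halfMember_three_of_chain_rows` ∕ `legDriftRows_halfMember_three_of_chain_rows`, DISCHARGED
for every rate `δ ≤ δ₀`** (`|ε| ≤ 1`; the even member is `ε = 1`). -/
theorem firstWindow_rows_halfMember_three (hLc : 1 ≤ Lc) (hr : r ∈ box (3 + 1) Lc) (cE cVH cΛ cE₂ cB : ℝ) (Tc : Fin 4 → Fin 4 → Fin 4 → Fin 4 → ℝ)
    {vh₂S : (Fin (3 + 1) → (Fin (3 + 1) → ℤ) → Fin (3 + 1) → (Fin (3 + 1) → ℤ) → MKer (3 + 1) (Fib 3))} (hB : ∃ C δ : ℝ, 0 < δ ∧ LocStencil₂ vh₂S C δ) {ε : ℝ} (hε : |ε| ≤ 1) (k₀ : ℕ) :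
    ∃ δ₀ : ℝ, 0 < δ₀ ∧ ∀ δ, 0 < δ → δ ≤ δ₀ → ∃ M : ℝ, 0 ≤ M ∧
      (∀ i, i < k₀ → LocStencil₂ (fun κ u κ' u' => rdiv ((((1 : ℝ) / 2) • (unitS₂ (sfStep Lc i) (smStep 3 Lc i) (T2RecAt 3 Lc (toSite r) cE cVH cΛ cE₂ cB Tc vh₂S (mixFFAt (toSite r) Lc) i) + ε • fun κ u κ' u' => sgnK (trK ((unitS₂ (sfStep Lc i) (smStep 3 Lc i) (T2RecAt 3 Lc (toSite r) cE cVH cΛ cE₂ cB Tc vh₂S (mixFFAt (toSite r) Lc) i)) κ u κ' u')))) κ u κ' u')) M δ) ∧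
      (∀ i, i < k₀ → LocStencil₂ ((fun κ u κ' u' => rdiv ((((1 : ℝ) / 2) • (unitS₂ (sfStep Lc (i + 1)) (smStep 3 Lc (i + 1)) (T2RecAt 3 Lc (toSite r) cE cVH cΛ cE₂ cB Tc vh₂S (mixFFAt (toSite r) Lc) (i + 1)) + ε • fun κ u κ' u' => sgnK (trK ((unitS₂ (sfStep Lc (i + 1)) (smStep 3 Lc (i + 1)) (T2RecAt 3 Lc (toSite r) cE cVH cΛ cE₂ cB Tc vh₂S (mixFFAt (toSite r) Lc) (i + 1))) κ u κ' u')))) κ u κ' u'))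
        - (fun κ u κ' u' => rdiv ((((1 : ℝ) / 2) • (unitS₂ (sfStep Lc i) (smStep 3 Lc i) (T2RecAt 3 Lc (toSite r) cE cVH cΛ cE₂ cB Tc vh₂S (mixFFAt (toSite r) Lc) i) + ε • fun κ u κ' u' => sgnK (trK ((unitS₂ (sfStep Lc i) (smStep 3 Lc i) (T2RecAt 3 Lc (toSite r) cE cVH cΛ cE₂ cB Tc vh₂S (mixFFAt (toSite r) Lc) i)) κ u κ' u')))) κ u κ' u'))) M δ) :=
  firstWindow_rows_halfMember (d := 3) hLc hr cE cVH cΛ cE₂ cB Tc hB hε k₀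

end Three

end Summit.QuantumFields.BalabanUV.Beta.GAN24.LegFirstWindowRows
end
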